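import Summits.BirchSwinnertonDyer.Rank1Residual.Additive.CyclotomicThreeDescentData
import Literature.NumberTheory.EllipticCurves.BSDQuadraticDescentTorsionOddPartProofs
import Literature.RingTheory.DiscreteValuationRing.AdicCompletionResidueField
import Mathlib.NumberTheory.NumberField.Cyclotomic.Ideal
import HarnessLib

/-!
# Line V14, `K = ℚ(ζ₃)`-side reduction data: the unique prime `𝔭 ∣ 3`, `k_𝔭 = 𝔽₃`,
# `#Ẽ_𝔭(k_𝔭) = #V(𝔽₃)`, `a_𝔭(V_K) = a₃(V)`, good reduction of `V_K` at `𝔭`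

HONEST FRAMING (cell `b2b-bsdres`, run/shared/lean/b2b/bsd-rank1-residual/, verbatim in every
file): the goal of the cell is to DELETE the COMBINATION-SHAPED residual classes of the
Birch–Swinnerton-Dyer formula for ALL analytic-rank `≤ 1` elliptic curves over `ℚ` — "full BSD
formula for every rank `≤ 1` curve in class `C`" assembled STRICTLY from published theorems — so
that the rank-`≤ 1` remainder becomes exactly the CONSTRUCTION-SHAPED classes, which are TYPED
(missing-input `Prop`s), NOT attempted. This is not "finishing BSD". The additive sub-cell (seats
additive-p1…p4) is a RESEARCH ROUTE on the construction-shaped classes X3/X4; no claim beyond the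
stated classes; the labels of X3 (and of X1, the class of the twist pairs) are UNCHANGED by this file;
nothing is booked here (booking is the referee's call).

Theorems only (no `def`, no `sorry`, no named fact). Purpose: the core theorem of line V14
(`X3CyclotomicThree.exists_padicVal_shaOrder_add_le`, `X3RankZeroCyclotomicThree.lean`) carries
Greenberg's Theorem 4.1 over `K = ℚ(ζ₃)` as the INLINE hypothesis `hGrK`, already specialised to the
`K`-SHAPE "one prime `𝔭 = (ζ₃ − 1)` above `3`, residue field `𝔽₃`, `Ẽ_𝔭 = V mod 3`". To replace it by
the VERBATIM number-field statement (named fact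
`Literature.NumberTheory.EllipticCurves.Greenberg1999.thm41_charValue_rankZero_numberField`, whose
anomalous factor is `∏_{v ∣ 3} #Ẽ_v(k_v)[3^∞]²` over Mathlib's local minimal models) one needs exactly
the following facts about `K` and the canonical model `V ⊗ K` of a globally minimal `V/ℚ` with good
reduction at `3`, proved here from Mathlib's cyclotomic-ideal theory
(`IsCyclotomicExtension.Rat.eq_span_zeta_sub_one_of_liesOver'`, `inertiaDeg_eq_of_prime`) and the
tree's minimal-model bookkeeping (`natCard_point_reduction_minimal`, `integralModel_eq_of_baseChange_eq`,
`natCard_point_map_ringEquiv`, `residueFieldEquiv`):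

* `exists_prime_over_three` — there is a finite place `𝔭` of `K` with `3 ∈ 𝔭`,
  `{v | 3 ∈ v} = {𝔭}` and `N(𝔭) = 3`;
* `natCard_residueField_adicCompletionIntegers_eq_three` — `#k_𝔭 = 3`;
* `natCard_point_reductionAt_baseChange_eq_reductionPointCount` — `#Ẽ_𝔭(k_𝔭) = #V(𝔽₃)` (the
  reduction of Mathlib's chosen minimal model of `V_K ⊗ K_𝔭` vs the reduction mod `3` of the global
  minimal model of `V`: `V ⊗ 𝒪_𝔭` is an integral model with unit discriminant, two minimal models have
  reductions with equally many points — Silverman VII.1.3(b) — and `k_𝔭 ≃ ℤ/3`);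
* `frobeniusTraceAt_baseChange_eq_frobeniusTrace_three` — `a_𝔭(V_K) = a₃(V)`;
* `hasGoodReductionAt_baseChange_of_mem_three` — `V_K` has good reduction at `𝔭`;
* `natCard_primaryComponent_point_reductionAt_eq` — `#Ẽ_𝔭(k_𝔭)[3^∞] = #V(𝔽₃)[3^∞]`.

References: Silverman, *AEC*, VII.1 Prop. 1.3(b), VII.2, VII.5 Prop. 5.1(a); Washington,
*Introduction to Cyclotomic Fields*, GTM 83, Lemma 1.4 (`(1 − ζ_p)` is the unique prime above `p` in
`ℚ(ζ_p)`, totally ramified) — here through Mathlib (`Mathlib.NumberTheory.NumberField.Cyclotomic.Ideal`).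
-/

noncomputable section

open scoped Classical NumberField

open WeierstrassCurve NumberField IsDedekindDomain IsLocalRing
  Literature.NumberTheory.EllipticCurves

namespace Summit.BirchSwinnertonDyer.Rank1Residual.Additive

/-! ## §1 The unique prime of `ℚ(ζ₃)` above `3` -/

section PrimeOverThree

variable (K : Type) [Field K] [NumberField K] [IsCyclotomicExtension {3} ℚ K]

/-- **`3` is totally ramified in `K = ℚ(ζ₃)`**: there is a finite place `𝔭` (namely `(ζ₃ − 1)`) with
`3 ∈ 𝔭`, every finite place containing `3` equals `𝔭`, and `N(𝔭) = 3` (residue degree `1`).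
Mathlib: `IsCyclotomicExtension.Rat.eq_span_zeta_sub_one_of_liesOver'`, `inertiaDeg_eq_of_prime`,
`Ideal.pow_inertiaDeg`. [folklore] -/
theorem exists_prime_over_three :
    ∃ 𝔭 : HeightOneSpectrum (𝓞 K), ((3 : ℕ) : 𝓞 K) ∈ 𝔭.asIdeal ∧
      {v : HeightOneSpectrum (𝓞 K) | ((3 : ℕ) : 𝓞 K) ∈ v.asIdeal} = {𝔭} ∧
      Ideal.absNorm 𝔭.asIdeal = 3 := by
  have hζ := IsCyclotomicExtension.zeta_spec 3 ℚ K
  have hprime : Prime (hζ.toInteger - 1) := hζ.zeta_sub_one_prime'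
  have hP : (Ideal.span {hζ.toInteger - 1}).IsPrime :=
    (Ideal.span_singleton_prime hprime.ne_zero).mpr hprime
  have hPne : Ideal.span {hζ.toInteger - 1} ≠ ⊥ := by
    rw [Ne, Ideal.span_singleton_eq_bot]
    exact hprime.ne_zero
  let 𝔭 : HeightOneSpectrum (𝓞 K) := ⟨Ideal.span {hζ.toInteger - 1}, hP, hPne⟩
  have h3 : ((3 : ℕ) : 𝓞 K) ∈ 𝔭.asIdeal := by
    have h := (IsCyclotomicExtension.Rat.zeta_sub_one_dvd_intCast_iff' 3 hζ (n := 3)).mpr dvd_rfl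
    rw [Ideal.mem_span_singleton]
    exact_mod_cast h
  refine ⟨𝔭, h3, ?_, ?_⟩
  · ext v
    simp only [Set.mem_setOf_eq, Set.mem_singleton_iff]
    constructor
    · intro hv
      haveI : v.asIdeal.LiesOver (Ideal.span {((3 : ℕ) : ℤ)}) :=
        Ideal.liesOver_span_of_natCast_mem' Nat.prime_three hv
      exact HeightOneSpectrum.ext
        (IsCyclotomicExtension.Rat.eq_span_zeta_sub_one_of_liesOver' 3 K hζ v.asIdeal)
    · rintro rfl
      exact h3
  · haveI : 𝔭.asIdeal.LiesOver (Ideal.span {((3 : ℕ) : ℤ)}) :=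
      Ideal.liesOver_span_of_natCast_mem' Nat.prime_three h3
    have h1 := IsCyclotomicExtension.Rat.inertiaDeg_eq_of_prime 3 K 𝔭.asIdeal
    have h2 := Ideal.pow_inertiaDeg 3 𝔭.asIdeal
    rw [h1, pow_one] at h2
    exact h2.symm

end PrimeOverThree

section ResidueField

variable {K : Type} [Field K] [NumberField K]

/-- `#k_𝔭 = 3` for the residue field of the completion `𝒪_𝔭` at a place of norm `3`. [folklore] -/
theorem natCard_residueField_adicCompletionIntegers_eq_three (𝔭 : HeightOneSpectrum (𝓞 K))
    (hN : Ideal.absNorm 𝔭.asIdeal = 3) :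
    Nat.card (ResidueField (𝔭.adicCompletionIntegers K)) = 3 := by
  rw [HeightOneSpectrum.natCard_residueField_adicCompletionIntegers K 𝔭, ← Submodule.cardQuot_apply,
    ← Ideal.absNorm_apply, hN]

end ResidueField

/-! ## §2 The canonical model `V ⊗ K` at the prime above `3` -/

section Reduction

variable {K : Type} [Field K] [NumberField K]
  (V : WeierstrassCurve ℚ) [V.IsElliptic] [V.IsGloballyMinimal]

/-- **`V_K` has good reduction at a place `𝔭 ∣ 3` when `3 ∤ Δ_min(V)`**, and the model `V ⊗ K` is
minimal at `𝔭` (unit discriminant; Silverman VII.5.1(a), VII.1). Extracted from the proof of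
`localTamagawaNumber_baseChange_eq_one_of_mem` (`CyclotomicThreeDescentData`). [folklore] -/
theorem isMinimalAt_and_hasGoodReductionAt_baseChange_of_mem {p : ℕ} [hp : Fact p.Prime]
    (hΔ : ¬ (p : ℤ) ∣ minimalDiscriminantInt V) (w : HeightOneSpectrum (𝓞 K))
    (hpw : (p : 𝓞 K) ∈ w.asIdeal) :
    (V.baseChange K).IsMinimalAt w ∧ (V.baseChange K).HasGoodReductionAt w := by
  have hval : w.valuation K (V.baseChange K).Δ = 1 := by
    rw [← baseChange_integralModelInt_eq]
    exact valuation_Δ_baseChange_int_eq_one (integralModelInt V) w hp.out hpw hΔ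
  have hint : (V.baseChange K).IsIntegralAt w := by
    rw [← baseChange_integralModelInt_eq]
    exact isIntegralAt_baseChange_intModel (integralModelInt V) w
  have hmin : (V.baseChange K).IsMinimalAt w := by
    refine isMinimalAt_of_lt_valuation_Δ_holds hint ?_
    rw [hval, ← WithZero.exp_zero, WithZero.exp_lt_exp]
    norm_num
  have hord : (V.baseChange K).ordMinimalDiscriminant w = 0 := by
    have h := valuation_Δ_eq_of_isMinimalAt_holds (v := w) (W := V.baseChange K) hmin
    rw [hval, eq_comm, WithZero.exp_eq_one] at h
    omega
  exact ⟨hmin, (ordMinimalDiscriminant_eq_zero_iff_holds w (V.baseChange K)).mp hord⟩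

/-- **`#Ẽ_𝔭(k_𝔭) = #V(𝔽₃)`.** For `V/ℚ` globally minimal with `3 ∤ Δ_min(V)` and a place `𝔭` of `K`
with `3 ∈ 𝔭`, `N(𝔭) = 3`: the reduction at `𝔭` of Mathlib's chosen minimal model of `V_K ⊗ K_𝔭` (the
curve `(V.baseChange K).reductionAt 𝔭` counted by `frobeniusTraceAt`) has as many `k_𝔭`-points as the
reduction mod `3` of the global minimal model of `V` (`reductionPointCount V 3`). Two minimal models
have reductions with equally many points (Silverman VII.1.3(b), tree `natCard_point_reduction_minimal`);
the integral model of `V_K ⊗ K_𝔭` is `V_ℤ ⊗ 𝒪_𝔭`; `k_𝔭 ≃ ℤ/3`.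
[cite: SilvermanAEC2009, Prop. VII.1.3(b) and §VII.2] -/
theorem natCard_point_reductionAt_baseChange_eq_reductionPointCount (𝔭 : HeightOneSpectrum (𝓞 K))
    (h3 : ((3 : ℕ) : 𝓞 K) ∈ 𝔭.asIdeal) (hN : Ideal.absNorm 𝔭.asIdeal = 3)
    (hΔ : ¬ (3 : ℤ) ∣ minimalDiscriminantInt V) :
    Nat.card ((V.baseChange K).reductionAt 𝔭).toAffine.Point = reductionPointCount V 3 := by
  set R := 𝔭.adicCompletionIntegers K with hR
  set X : WeierstrassCurve (𝔭.adicCompletion K) := (V.baseChange K).baseChange (𝔭.adicCompletion K)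
    with hX
  haveI hmin : X.IsMinimal R :=
    (isMinimalAt_and_hasGoodReductionAt_baseChange_of_mem V (p := 3)
      (by exact_mod_cast hΔ) 𝔭 h3).1
  have hΔX : X.Δ ≠ 0 := by
    rw [hX, baseChange, map_Δ, baseChange, map_Δ]
    refine (map_ne_zero _).mpr ((map_ne_zero _).mpr V.isUnit_Δ.ne_zero)
  -- Mathlib's chosen minimal model vs the given minimal equation
  have h1 : Nat.card ((V.baseChange K).reductionAt 𝔭).toAffine.Point =
      Nat.card (X.reduction R).toAffine.Point := by
    rw [← natCard_point_reduction_minimal X hΔX]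
    rfl
  -- the integral model of `X` is `V_ℤ ⊗ 𝒪_𝔭`
  have h2 : X.integralModel R = (integralModelInt V).map (Int.castRingHom R) := by
    refine integralModel_eq_of_baseChange_eq _ _ ?_
    rw [hX]
    conv_rhs => rw [← map_integralModelInt V]
    rw [baseChange, baseChange, baseChange, map_map, map_map, map_map]
    exact congrArg (integralModelInt V).map (RingHom.ext_int _ _)
  -- the residue field has three elements
  have hk : Nat.card (ResidueField R) = 3 := natCard_residueField_adicCompletionIntegers_eq_three 𝔭 hN
  haveI : Finite (ResidueField R) := Nat.finite_of_card_ne_zero (by rw [hk]; norm_num)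
  letI : Fintype (ResidueField R) := Fintype.ofFinite _
  have hcard : Fintype.card (ResidueField R) = 3 := by rw [Fintype.card_eq_nat_card, hk]
  let e : ZMod 3 ≃+* ResidueField R := ZMod.ringEquivOfPrime (ResidueField R) Nat.prime_three hcard
  have h3' : X.reduction R =
      ((integralModelInt V).map (Int.castRingHom (ZMod 3))).map (e : ZMod 3 →+* ResidueField R) := by
    rw [reduction, h2, map_map, map_map]
    exact congrArg (integralModelInt V).map (RingHom.ext_int _ _)
  rw [h1, h3', natCard_point_map_ringEquiv, reductionPointCount]

/-- **`a_𝔭(V_K) = a₃(V)`** at the prime `𝔭 ∣ 3` of norm `3` (`V/ℚ` globally minimal, `3 ∤ Δ_min(V)`):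
the place-indexed trace of Frobenius of `V_K` (tree `frobeniusTraceAt`: `#k_𝔭 + 1 − #Ẽ_𝔭(k_𝔭)`)
equals the prime-indexed `V.frobeniusTrace 3 = 3 + 1 − #V(𝔽₃)`. [cite: SilvermanAEC2009, C.§16 with Prop. VII.1.3(b)] -/
theorem frobeniusTraceAt_baseChange_eq_frobeniusTrace_three (𝔭 : HeightOneSpectrum (𝓞 K))
    (h3 : ((3 : ℕ) : 𝓞 K) ∈ 𝔭.asIdeal) (hN : Ideal.absNorm 𝔭.asIdeal = 3)
    (hΔ : ¬ (3 : ℤ) ∣ minimalDiscriminantInt V) :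
    (V.baseChange K).frobeniusTraceAt 𝔭 = V.frobeniusTrace 3 := by
  rw [frobeniusTraceAt_def, natCard_residueField_adicCompletionIntegers_eq_three 𝔭 hN,
    natCard_point_reductionAt_baseChange_eq_reductionPointCount V 𝔭 h3 hN hΔ, frobeniusTrace, Nat.cast_ofNat]

/-- **`#Ẽ_𝔭(k_𝔭)[3^∞] = #V(𝔽₃)[3^∞]`**: the `3`-primary parts of the two (equinumerous) finite groups
of points have the same order (`= 3^{v₃(#·)}`, tree `natCard_primaryComponent_eq_pow_padicValNat`).
[folklore] -/
theorem natCard_primaryComponent_point_reductionAt_eq (𝔭 : HeightOneSpectrum (𝓞 K))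
    (h3 : ((3 : ℕ) : 𝓞 K) ∈ 𝔭.asIdeal) (hN : Ideal.absNorm 𝔭.asIdeal = 3)
    (hΔ : ¬ (3 : ℤ) ∣ minimalDiscriminantInt V) :
    Nat.card (AddCommGroup.primaryComponent ((V.baseChange K).reductionAt 𝔭).toAffine.Point 3) =
      Nat.card (AddCommGroup.primaryComponent
        ((integralModelInt V).map (Int.castRingHom (ZMod 3))).toAffine.Point 3) := by
  have hc := natCard_point_reductionAt_baseChange_eq_reductionPointCount V 𝔭 h3 hN hΔ
  haveI : Finite ((V.baseChange K).reductionAt 𝔭).toAffine.Point := by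
    refine Nat.finite_of_card_ne_zero ?_
    rw [hc, reductionPointCount]
    exact Nat.card_pos.ne'
  rw [natCard_primaryComponent_eq_pow_padicValNat, natCard_primaryComponent_eq_pow_padicValNat, hc,
    reductionPointCount]

end Reduction

end Summit.BirchSwinnertonDyer.Rank1Residual.Additive

end
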